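import Summits.QuantumFields.BalabanUV.Beta.ChartConjugationRelative

/-!
# `BalabanUV.Beta.ChartConjugationDefect` — the chart-conjugation identity WITH ITS DEFECT, for an ARBITRARY spread pair `(A, 𝕄)`
# (β sub-cell, row D1, the OWNER an2-g26's K4 «statement first» D-K4-1, file K4a of K4a ∕ K4b ∕ K4c; CLAIMS l.26301 (2); Lean by the
# K-U3d L2 author lineage t4-ne9-formalise-leaf-06 under the owner's FIRST REFUSAL R-5, «MINE K4a» CLAIMS l.26505)

HONEST FRAMING (cell contract, verbatim): «discharging `BetaPertH` makes Bałaban's UV stability UNCONDITIONAL — a real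
constructive-QFT result; it is NOT the continuum limit and NOT the Clay problem.»  THIS MODULE is elementary algebra of matrix-fibred
lattice kernels (absolutely convergent compositions and traces): it formalises NO statement printed in Bałaban's papers, cites none as a
hypothesis, mints no `def` and no `Prop` fact, instantiates NO binder of the wall and DISCHARGES NOTHING of it.  NOT summit progress;
NOT D1; NOT BetaPertH; NOT continuum; NOT Clay.

ABSOLUTE RULE (cell, verbatim): «No internally-minted statement may enter as a cited fact. Every hypothesis is either
kernel-proved in this package or a verbatim quotation of a PUBLISHED theorem with page reference. The manuscript(s) under
audit are NOT citable for their own disputed steps — they are the thing under adjudication; programme-internal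
(2001/route/tribunal) claims are never citable.»  Every theorem below is kernel-proved from explicit, abstract hypotheses.

PLACEMENT.  New cell work about the cell's OWN typed objects, under the registered cell topic `Summits/QuantumFields/BalabanUV/Beta/`;
imports `ChartConjugationRelative` ONLY (owner's architecture decision, l.26301 (2)); imported by nothing under `Literature/`.

WHY (owner an2-g26, K4 ARCHITECTURE DECISION, CLAIMS l.26301 (2)).  an5's `ChartConjugation.hess_conj_invariant` needs a TWO-SIDED inverse
`A∘𝕄 = idK = 𝕄∘A`; an2's `ChartConjugationRelative.hess_conj_invariant_rel` needs `RelInv A 𝕄 E` AND the commutations `E∘X = X∘E` of the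
contact generators with the slice projector.  For the symmetrised slice letters (JsB12Sym) the generators do NOT commute with `E`
(an3-g48, THEOREM CX, `HOME/b2b-balaban-beta-an3/gen48/CX-COMMUTATOR.v1.md` §2: `C_X = [E, X]` has rank 2 at every interior jet bond).
The owner therefore splits the SX identities in two files: THIS FILE (K4a) = the chart-conjugation identity WITH ITS DEFECT for an
ARBITRARY spread pair `(A, 𝕄)` — NO inverse relation at all; K4b (`ChartConjugationRelativeSX`, imports this file) = over `RelInv A 𝕄 E`
the defects are commutator-valued.  Two exact-ℚ engines of the statement list exist on the owner's side (`work/sx_check.py` 17∕17,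
`work/sx_check2.py` 3∕3 — no relation between `A` and `𝕄`) and one on an3's (`gen48/toy/sx_defect.py` 10∕10, memo §4 ∕ §4b = the same list
symbol for symbol); THIS FILE is the kernel proof — engines are evidence, the theorems below are the certificate.

CONTENT (the owner's signatures VERBATIM; `0 def`: the two defects are DISPLAYED INLINE).  With the SANDWICH DEFECT
`S_X := comp (comp A (conjV 𝕄 X)) A + conjV A X` (= `A[𝕄,X]A − [X,A]`, the amount by which the resolvent sandwich identity
`A(𝕄X − X𝕄)A = XA − AX` fails) and the TRACE DEFECT `τ(Y) := tr (comp Y (conjV 𝕄 A))` (= `tr(Y·[𝕄,A])`):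
§1 `loc_sandwichDefect` (`S_X` is localised).  §2 `sandwich_defect : (A∘conjV 𝕄 X)∘(A∘Z) = X∘(A∘Z) − (A∘X)∘Z + S_X∘Z`;
`bubble_conjV_left_defect`, `bubble_conjV_right_defect`; `tadpole_conjW₁_defect : tadpole A (conjW₁ V V′ X X′) = bubble A (conjV 𝕄 X) V′
+ bubble A V (conjV 𝕄 X′) − tr(S_X∘V′) − tr(S_{X′}∘V)`; `tadpole_conjW₂_defect : tadpole A (conjW₂ 𝕄 X X′ X₂) = bubble A (conjV 𝕄 X) (conjV 𝕄 X′)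
− tr(S_X∘conjV 𝕄 X′) + τ(X′∘X) − τ(X₂)`; `tadpole_conjW_defect` (their sum); **`hess_conj_defect`**:
`½·tadpole A (W + conjW 𝕄 V V′ X X′ X₂) − ½·bubble A (V + conjV 𝕄 X) (V′ + conjV 𝕄 X′) = ½·tadpole A W − ½·bubble A V V′ + Δ`,
`Δ := ½(τ(X′∘X) − τ(X₂)) − ½(tr(S_X∘V′) + tr(S_{X′}∘V) + tr(S_X∘conjV 𝕄 X′))` — a UNIVERSAL identity: hypotheses `Spr A`, `Spr 𝕄` and
localised letters ONLY.  §3 TWO-SIDED SOCKETS: under `comp A 𝕄 = idK`, `comp 𝕄 A = idK` one has `S_X = 0` (`sandwichDefect_of_two_sided`),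
`conjV 𝕄 A = 0` (`conjV_self_of_two_sided`), hence `Δ = 0` (`delta_of_two_sided`), and an5's `hess_conj_invariant` is RECOVERED from
`hess_conj_defect` (closing `example`, by `rw`).  The relative sockets (`RelInv A 𝕄 E` ⇒ `S_X`, `τ` commutator-valued) are K4b's.

RELATION TO THE TREE (no duplication): the contacts `conjV` ∕ `conjW₁` ∕ `conjW₂` ∕ `conjW`, their `Loc`-closure, `tadpole_comm_pair`,
`comp_conjV` are an5's (`ChartConjugation`), `spr_comp` is an2's (`ChartConjugationRelative`), every analytic brick is `TameKernelCalculus`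
— all USED BY NAME; the proofs are an5's §2 line by line with the two uses of `A∘𝕄 = 1` ∕ `𝕄∘A = 1` replaced by the displayed defect words.
NOT continuum, NOT Clay.
-/

open Finset
open scoped BigOperators
open Literature.MathematicalPhysics.QuantumFieldTheory.Balaban1983to89
open Literature.MathematicalPhysics.QuantumFieldTheory.Balaban1983to89.Beta
open ExpKernelCalculus (MKer Decays BiLoc comp tr bubble tadpole)
open HessKerSchurResolvent (idK comp_idK_left comp_idK_right)
open Summit.QuantumFields.BalabanUV.Beta.TameKernelCalculus
open Summit.QuantumFields.BalabanUV.Beta.ChartConjugation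
open Summit.QuantumFields.BalabanUV.Beta.ChartConjugationRelative (spr_comp)

namespace Summit.QuantumFields.BalabanUV.Beta.ChartConjugationDefect

noncomputable section

variable {D : ℕ} {F : Type*} [Fintype F]

/-! ## §1 The sandwich defect is localised -/

/-- The SANDWICH DEFECT `S_X = (A∘conjV 𝕄 X)∘A + conjV A X` of a spread pair `(A, 𝕄)` and a localised generator `X` is localised. -/
theorem loc_sandwichDefect {A M X : MKer D F} (hA : Spr A) (hM : Spr M) (hX : Loc X) :
    Loc (comp (comp A (conjV M X)) A + conjV A X) :=
  (((hA.comp_loc (loc_conjV hM hX)).comp_spr hA)).add (loc_conjV hA hX)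

/-! ## §2 The defect identities — NO inverse relation between `A` and `𝕄` -/

section Defect

variable {A M : MKer D F}

/-- **THE SANDWICH IDENTITY WITH DEFECT** (universal): `(A ∘ conjV 𝕄 X) ∘ (A ∘ Z) = X ∘ (A∘Z) − (A∘X) ∘ Z + S_X ∘ Z` with
`S_X = (A∘conjV 𝕄 X)∘A + conjV A X` — for spread `A`, `𝕄` (NO relation between them) and localised `X`, `Z`.  With `A∘𝕄 = idK = 𝕄∘A`,
`S_X = 0` (`sandwichDefect_of_two_sided`) and this is an5's `ChartConjugation.sandwich`. -/
theorem sandwich_defect (hA : Spr A) (hM : Spr M) {X Z : MKer D F} (hX : Loc X) (hZ : Loc Z) :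
    comp (comp A (conjV M X)) (comp A Z)
      = comp X (comp A Z) - comp (comp A X) Z + comp (comp (comp A (conjV M X)) A + conjV A X) Z := by
  have hAcV : Loc (comp A (conjV M X)) := hA.comp_loc (loc_conjV hM hX)
  have hAX : Loc (comp A X) := hA.comp_loc hX
  have hXA : Loc (comp X A) := hX.comp_spr hA
  rw [comp_add_left_tame (hAcV.comp_spr hA).tame (loc_conjV hA hX).tame hZ.tame, show conjV A X = comp A X - comp X A from rfl,
    comp_sub_left_tame hAX.tame hXA.tame hZ.tame, ← comp_assoc_tame hAcV.tame hA.tame hZ.tame, ← comp_assoc_tame hX.tame hA.tame hZ.tame]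
  abel

/-- Bubble with a first-slot contact, WITH DEFECT: `bubble A (conjV 𝕄 X) Z = tr(X∘(A∘Z)) − tr((A∘X)∘Z) + tr(S_X∘Z)`. -/
theorem bubble_conjV_left_defect (hA : Spr A) (hM : Spr M) {X Z : MKer D F} (hX : Loc X) (hZ : Loc Z) :
    bubble A (conjV M X) Z
      = tr (comp X (comp A Z)) - tr (comp (comp A X) Z) + tr (comp (comp (comp A (conjV M X)) A + conjV A X) Z) := by
  have hS := loc_sandwichDefect hA hM hX
  have hAZ := hA.comp_loc hZ
  have hAX := hA.comp_loc hX
  unfold ExpKernelCalculus.bubble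
  rw [sandwich_defect hA hM hX hZ, tr_add_loc ((hX.comp hAZ).sub (hAX.comp hZ)) (hS.comp hZ), tr_sub_loc (hX.comp hAZ) (hAX.comp hZ)]

/-- Bubble with a second-slot contact, WITH DEFECT: `bubble A Y (conjV 𝕄 X′) = tr((A∘Y)∘X′) − tr((A∘X′)∘Y) + tr(S_{X′}∘Y)`. -/
theorem bubble_conjV_right_defect (hA : Spr A) (hM : Spr M) {Y Xp : MKer D F} (hY : Loc Y) (hXp : Loc Xp) :
    bubble A Y (conjV M Xp)
      = tr (comp (comp A Y) Xp) - tr (comp (comp A Xp) Y) + tr (comp (comp (comp A (conjV M Xp)) A + conjV A Xp) Y) := by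
  have hS := loc_sandwichDefect hA hM hXp
  have hAY := hA.comp_loc hY
  have hAXp := hA.comp_loc hXp
  unfold ExpKernelCalculus.bubble
  rw [tr_comp_comm_loc hAY (hA.comp_loc (loc_conjV hM hXp)).tame, sandwich_defect hA hM hXp hY,
    tr_add_loc ((hXp.comp hAY).sub (hAXp.comp hY)) (hS.comp hY), tr_sub_loc (hXp.comp hAY) (hAXp.comp hY),
    tr_comp_comm_loc hXp hAY.tame]

/-- **FIRST-ORDER DEFECT** (universal): `tadpole A (conjW₁ V V′ X X′) = bubble A (conjV 𝕄 X) V′ + bubble A V (conjV 𝕄 X′) − tr(S_X∘V′) − tr(S_{X′}∘V)`. -/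
theorem tadpole_conjW₁_defect (hA : Spr A) (hM : Spr M) {V Vp X Xp : MKer D F} (hV : Loc V) (hVp : Loc Vp) (hX : Loc X)
    (hXp : Loc Xp) :
    tadpole A (conjW₁ V Vp X Xp)
      = bubble A (conjV M X) Vp + bubble A V (conjV M Xp)
        - tr (comp (comp (comp A (conjV M X)) A + conjV A X) Vp) - tr (comp (comp (comp A (conjV M Xp)) A + conjV A Xp) V) := by
  unfold conjW₁
  rw [tadpole_add hA ((hVp.comp hX).sub (hX.comp hVp)) ((hV.comp hXp).sub (hXp.comp hV)), tadpole_comm_pair hA hVp hX,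
    tadpole_comm_pair hA hV hXp, bubble_conjV_left_defect hA hM hX hVp, bubble_conjV_right_defect hA hM hV hXp,
    tr_comp_comm_loc (hA.comp_loc hVp) hX.tame]
  ring

/-- **QUADRATIC DEFECT** (universal): `tadpole A (conjW₂ 𝕄 X X′ X₂) = bubble A (conjV 𝕄 X) (conjV 𝕄 X′) − tr(S_X∘conjV 𝕄 X′) + τ(X′∘X) − τ(X₂)`
with the TRACE DEFECT `τ(Y) = tr(Y∘conjV 𝕄 A)` — the `[𝕄, X₂]` tadpole is `−τ(X₂)` (no longer `0`), and the four cyclic re-associations of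
an5's proof close up to `τ(X′∘X)` and the sandwich defect. -/
theorem tadpole_conjW₂_defect (hA : Spr A) (hM : Spr M) {X Xp X₂ : MKer D F} (hX : Loc X) (hXp : Loc Xp) (hX₂ : Loc X₂) :
    tadpole A (conjW₂ M X Xp X₂)
      = bubble A (conjV M X) (conjV M Xp) - tr (comp (comp (comp A (conjV M X)) A + conjV A X) (conjV M Xp))
        + tr (comp (comp Xp X) (conjV M A)) - tr (comp X₂ (conjV M A)) := by
  have hAM : Spr (comp A M) := spr_comp hA hM
  have hMA : Spr (comp M A) := spr_comp hM hA
  have hXXp := hX.comp hXp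
  have hXpX := hXp.comp hX
  have hXM := hX.comp_spr hM
  have hXpM := hXp.comp_spr hM
  have hAX := hA.comp_loc hX
  have hMXp := hM.comp_loc hXp
  have hMX₂ := hM.comp_loc hX₂
  have hX₂M := hX₂.comp_spr hM
  have hAMXp := hA.comp_loc hMXp
  have hAXpM := hA.comp_loc hXpM
  have hP := (hXXp.comp_spr hM).add (hXpX.comp_spr hM)
  have hQ := (hXM.comp hXp).add (hXpM.comp hX)
  -- the right-hand side, word by word
  have h1 : tr (comp X (comp A (conjV M Xp))) = tr (comp X (comp A (comp M Xp))) - tr (comp X (comp A (comp Xp M))) := by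
    unfold conjV
    rw [comp_sub_right_tame hA.tame hMXp.tame hXpM.tame, comp_sub_right_tame hX.tame hAMXp.tame hAXpM.tame,
      tr_sub_loc (hX.comp hAMXp) (hX.comp hAXpM)]
  have h2 : tr (comp (comp A X) (conjV M Xp)) = tr (comp (comp A X) (comp M Xp)) - tr (comp (comp A X) (comp Xp M)) := by
    unfold conjV
    rw [comp_sub_right_tame hAX.tame hMXp.tame hXpM.tame, tr_sub_loc (hAX.comp hMXp) (hAX.comp hXpM)]
  have h3 : tr (comp (comp Xp X) (conjV M A)) = tr (comp (comp Xp X) (comp M A)) - tr (comp (comp Xp X) (comp A M)) := by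
    unfold conjV
    rw [comp_sub_right_tame hXpX.tame hMA.tame hAM.tame, tr_sub_loc (hXpX.comp_spr hMA) (hXpX.comp_spr hAM)]
  have h4 : tr (comp X₂ (conjV M A)) = tr (comp X₂ (comp M A)) - tr (comp X₂ (comp A M)) := by
    unfold conjV
    rw [comp_sub_right_tame hX₂.tame hMA.tame hAM.tame, tr_sub_loc (hX₂.comp_spr hMA) (hX₂.comp_spr hAM)]
  -- the left-hand side, expanded as in an5's `tadpole_conjW₂`
  have hL : tadpole A (conjW₂ M X Xp X₂)
      = tr (comp A (comp (comp X Xp) M)) + tr (comp A (comp (comp Xp X) M))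
        - (tr (comp A (comp (comp X M) Xp)) + tr (comp A (comp (comp Xp M) X)))
        + (tr (comp A (comp M X₂)) - tr (comp A (comp X₂ M))) := by
    unfold conjW₂ ExpKernelCalculus.tadpole
    rw [comp_add_right_tame hA.tame (hP.sub hQ).tame (hMX₂.sub hX₂M).tame,
      tr_add_loc (hA.comp_loc (hP.sub hQ)) (hA.comp_loc (hMX₂.sub hX₂M)),
      comp_sub_right_tame hA.tame hP.tame hQ.tame, tr_sub_loc (hA.comp_loc hP) (hA.comp_loc hQ),
      comp_add_right_tame hA.tame (hXXp.comp_spr hM).tame (hXpX.comp_spr hM).tame,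
      tr_add_loc (hA.comp_loc (hXXp.comp_spr hM)) (hA.comp_loc (hXpX.comp_spr hM)),
      comp_add_right_tame hA.tame (hXM.comp hXp).tame (hXpM.comp hX).tame,
      tr_add_loc (hA.comp_loc (hXM.comp hXp)) (hA.comp_loc (hXpM.comp hX)),
      comp_sub_right_tame hA.tame hMX₂.tame hX₂M.tame, tr_sub_loc (hA.comp_loc hMX₂) (hA.comp_loc hX₂M)]
  -- cyclic re-associations (no inverse relation used anywhere)
  have e1 : tr (comp A (comp (comp X Xp) M)) = tr (comp (comp A X) (comp Xp M)) := by
    rw [← comp_assoc_tame hX.tame hXp.tame hM.tame, comp_assoc_tame hA.tame hX.tame hXpM.tame]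
  have e2 : tr (comp A (comp (comp Xp X) M)) = tr (comp (comp Xp X) (comp M A)) := by
    rw [← tr_comp_comm_loc (hXpX.comp_spr hM) hA.tame, ← comp_assoc_tame hXpX.tame hM.tame hA.tame]
  have e3 : tr (comp A (comp (comp X M) Xp)) = tr (comp (comp A X) (comp M Xp)) := by
    rw [comp_assoc_tame hA.tame hXM.tame hXp.tame, comp_assoc_tame hA.tame hX.tame hM.tame, ← comp_assoc_tame hAX.tame hM.tame hXp.tame]
  have e4 : tr (comp A (comp (comp Xp M) X)) = tr (comp X (comp A (comp Xp M))) := by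
    rw [comp_assoc_tame hA.tame hXpM.tame hX.tame, ← tr_comp_comm_loc hX hAXpM.tame]
  have e5 : tr (comp A (comp M X₂)) = tr (comp X₂ (comp A M)) := by
    rw [comp_assoc_tame hA.tame hM.tame hX₂.tame, ← tr_comp_comm_loc hX₂ hAM.tame]
  have e6 : tr (comp A (comp X₂ M)) = tr (comp X₂ (comp M A)) := by
    rw [← tr_comp_comm_loc hX₂M hA.tame, ← comp_assoc_tame hX₂.tame hM.tame hA.tame]
  have e7 : tr (comp X (comp A (comp M Xp))) = tr (comp (comp Xp X) (comp A M)) := by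
    rw [tr_comp_comm_loc hX hAMXp.tame, comp_assoc_tame hA.tame hM.tame hXp.tame, ← comp_assoc_tame hAM.tame hXp.tame hX.tame,
      ← tr_comp_comm_loc hXpX hAM.tame]
  rw [hL, bubble_conjV_left_defect hA hM hX (loc_conjV hM hXp), h1, h2, h3, h4, e1, e2, e3, e4, e5, e6, e7]
  ring

/-- **THE DEFECT IDENTITY, UNIVERSAL FORM**: the tadpole of the second-order contact equals the contact part of the bubble MINUS the
three sandwich-defect traces PLUS the trace-defect pair —
`tadpole A (conjW …) = bubble A (conjV 𝕄 X) V′ + bubble A V (conjV 𝕄 X′) + bubble A (conjV 𝕄 X) (conjV 𝕄 X′)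
− (tr(S_X∘V′) + tr(S_{X′}∘V) + tr(S_X∘conjV 𝕄 X′)) + (τ(X′∘X) − τ(X₂))`. -/
theorem tadpole_conjW_defect (hA : Spr A) (hM : Spr M) {V Vp X Xp X₂ : MKer D F} (hV : Loc V) (hVp : Loc Vp) (hX : Loc X)
    (hXp : Loc Xp) (hX₂ : Loc X₂) :
    tadpole A (conjW M V Vp X Xp X₂)
      = bubble A (conjV M X) Vp + bubble A V (conjV M Xp) + bubble A (conjV M X) (conjV M Xp)
        - (tr (comp (comp (comp A (conjV M X)) A + conjV A X) Vp) + tr (comp (comp (comp A (conjV M Xp)) A + conjV A Xp) V)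
            + tr (comp (comp (comp A (conjV M X)) A + conjV A X) (conjV M Xp)))
        + (tr (comp (comp Xp X) (conjV M A)) - tr (comp X₂ (conjV M A))) := by
  unfold conjW
  rw [tadpole_add hA (loc_conjW₁ hV hVp hX hXp) (loc_conjW₂ hM hX hXp hX₂), tadpole_conjW₁_defect hA hM hV hVp hX hXp,
    tadpole_conjW₂_defect hA hM hX hXp hX₂]
  ring

/-- **`hess_conj_defect` — THE ASSEMBLED ONE-LOOP HESSIAN FORM UNDER CHART CONJUGATION, WITH ITS DEFECT** (universal; the owner's (D)):
for spread `A`, `𝕄` (NO inverse relation) and localised `V, V′, W, X, X′, X₂`,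
`½·tadpole A (W + conjW 𝕄 V V′ X X′ X₂) − ½·bubble A (V + conjV 𝕄 X) (V′ + conjV 𝕄 X′) = ½·tadpole A W − ½·bubble A V V′ + Δ`,
**`Δ := ½·(τ(X′∘X) − τ(X₂)) − ½·(tr(S_X∘V′) + tr(S_{X′}∘V) + tr(S_X∘conjV 𝕄 X′))`**, `S_X = (A∘conjV 𝕄 X)∘A + conjV A X`,
`τ(Y) = tr(Y∘conjV 𝕄 A)`.  `Δ = 0` under the two-sided sockets (`delta_of_two_sided`); commutator-valued under `RelInv` (K4b). -/
theorem hess_conj_defect (hA : Spr A) (hM : Spr M) {V Vp W X Xp X₂ : MKer D F} (hV : Loc V) (hVp : Loc Vp) (hW : Loc W)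
    (hX : Loc X) (hXp : Loc Xp) (hX₂ : Loc X₂) :
    (1 / 2 : ℝ) * tadpole A (W + conjW M V Vp X Xp X₂) - (1 / 2 : ℝ) * bubble A (V + conjV M X) (Vp + conjV M Xp)
      = (1 / 2 : ℝ) * tadpole A W - (1 / 2 : ℝ) * bubble A V Vp
        + ((1 / 2 : ℝ) * (tr (comp (comp Xp X) (conjV M A)) - tr (comp X₂ (conjV M A)))
          - (1 / 2 : ℝ) * (tr (comp (comp (comp A (conjV M X)) A + conjV A X) Vp)
              + tr (comp (comp (comp A (conjV M Xp)) A + conjV A Xp) V)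
              + tr (comp (comp (comp A (conjV M X)) A + conjV A X) (conjV M Xp)))) := by
  have hcV := loc_conjV hM hX
  have hcVp := loc_conjV hM hXp
  rw [tadpole_add hA hW (loc_conjW hM hV hVp hX hXp hX₂), bubble_add_left hA hV hcV (hVp.add hcVp), bubble_add_right hA hV hVp hcVp,
    bubble_add_right hA hcV hVp hcVp, tadpole_conjW_defect hA hM hV hVp hX hXp hX₂]
  ring

end Defect

/-! ## §3 The two-sided sockets: `S_X = 0`, `conjV 𝕄 A = 0`, `Δ = 0`, and an5's `hess_conj_invariant` recovered -/

section TwoSided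

variable [DecidableEq F] {A M : MKer D F}

/-- Under the two-sided sockets `A∘𝕄 = idK`, `𝕄∘A = idK` the commutator `conjV 𝕄 A = 𝕄∘A − A∘𝕄` vanishes (so every trace defect
`τ(Y) = tr(Y∘conjV 𝕄 A)` is a trace against `0`). -/
theorem conjV_self_of_two_sided (hAM : comp A M = idK) (hMA : comp M A = idK) : conjV M A = 0 := by
  rw [conjV, hMA, hAM, sub_self]

/-- Under the two-sided sockets the SANDWICH DEFECT vanishes: `(A∘conjV 𝕄 X)∘A + conjV A X = 0` (an5's `comp_conjV` and one
re-association through `𝕄∘A = 1`). -/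
theorem sandwichDefect_of_two_sided (hA : Spr A) (hM : Spr M) (hAM : comp A M = idK) (hMA : comp M A = idK) {X : MKer D F}
    (hX : Loc X) : comp (comp A (conjV M X)) A + conjV A X = 0 := by
  have hAX := hA.comp_loc hX
  rw [comp_conjV hA hM hAM hX, comp_sub_left_tame hX.tame (hAX.comp_spr hM).tame hA.tame, ← comp_assoc_tame hAX.tame hM.tame hA.tame,
    hMA, comp_idK_right, conjV]
  abel

/-- Under the two-sided sockets the defect `Δ` of `hess_conj_defect` vanishes. -/
theorem delta_of_two_sided (hA : Spr A) (hM : Spr M) (hAM : comp A M = idK) (hMA : comp M A = idK) {V Vp X Xp X₂ : MKer D F}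
    (hX : Loc X) (hXp : Loc Xp) :
    (1 / 2 : ℝ) * (tr (comp (comp Xp X) (conjV M A)) - tr (comp X₂ (conjV M A)))
        - (1 / 2 : ℝ) * (tr (comp (comp (comp A (conjV M X)) A + conjV A X) Vp)
            + tr (comp (comp (comp A (conjV M Xp)) A + conjV A Xp) V)
            + tr (comp (comp (comp A (conjV M X)) A + conjV A X) (conjV M Xp))) = 0 := by
  have hc0 : ∀ Z : MKer D F, comp (0 : MKer D F) Z = 0 := fun Z => by
    funext x z a b
    simp only [ExpKernelCalculus.comp, Pi.zero_apply, zero_mul, Finset.sum_const_zero, tsum_zero]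
  have ht0 : tr (0 : MKer D F) = 0 := by
    simp only [ExpKernelCalculus.tr, Pi.zero_apply, Finset.sum_const_zero, tsum_zero]
  rw [sandwichDefect_of_two_sided hA hM hAM hMA hX, sandwichDefect_of_two_sided hA hM hAM hMA hXp, conjV_self_of_two_sided hAM hMA,
    StepDriftWitness.comp_zero_right, StepDriftWitness.comp_zero_right, hc0, hc0, hc0, ht0]
  ring

/-- JUNCTION (an5's `ChartConjugation.hess_conj_invariant` RECOVERED from `hess_conj_defect` + `delta_of_two_sided`; an `example`, so
that no statement of the tree is re-declared). -/
example (hA : Spr A) (hM : Spr M) (hAM : comp A M = idK) (hMA : comp M A = idK) {V Vp W X Xp X₂ : MKer D F}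
    (hV : Loc V) (hVp : Loc Vp) (hW : Loc W) (hX : Loc X) (hXp : Loc Xp) (hX₂ : Loc X₂) :
    (1 / 2 : ℝ) * tadpole A (W + conjW M V Vp X Xp X₂) - (1 / 2 : ℝ) * bubble A (V + conjV M X) (Vp + conjV M Xp)
      = (1 / 2 : ℝ) * tadpole A W - (1 / 2 : ℝ) * bubble A V Vp := by
  rw [hess_conj_defect hA hM hV hVp hW hX hXp hX₂, delta_of_two_sided (V := V) (Vp := Vp) (X₂ := X₂) hA hM hAM hMA hX hXp, add_zero]

end TwoSided

end

end Summit.QuantumFields.BalabanUV.Beta.ChartConjugationDefect
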